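import Mathlib
import HarnessLib
import HarnessLib.Audit
import Summits.Langlands.Statement
import HarnessLib.Audit.Status.Attr

/-!
Route: SexticResolventInduction

# Route SexticResolventInduction — ζ_E12/ζ_E6 = L(σ)L(σ′) — even icosahedral Artin from the sextic
resolvent

X (it suffices to show) = K1 ∧ K2 for the EVEN ICOSAHEDRAL sector of conjunct (B) over ℚ (shared
target stmt-Langlands-2903 `EvenIcosahedralStrongArtin`: every irreducible even ρ : Γ_ℚ → GL₂(ℂ) of
icosahedral type has a cuspidal π on GL₂(𝔸_ℚ) with Satake–Frobenius matching a.e.; X → Langlands is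
the shared junction stmt-Langlands-2908). For even ρ the A₅-field L is totally real; its SEXTIC
RESOLVENT E₆ = L^(D₅) carries the quadratic character η of E₁₂ = L^(C₅), and Ind_(D₅)^(A₅)(sgn) = 3
⊕ 3′, i.e. Ind_(E₆)^ℚ η = Ad ρ ⊕ Ad ρ′ (ρ′ the Galois conjugate), so ζ_(E₁₂)(s)/ζ_(E₆)(s) = L(s, Ad
ρ)L(s, Ad ρ′). K1 (ResolventInduction): there are cuspidal σ, σ′ on GL₃(𝔸_ℚ) whose joint unramified
Satake data are the eigenvalues of (Ad ρ ⊕ Ad ρ′)(Frob_p) — written ρ-intrinsically as {u,1,u⁻¹} ⊔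
{u²,1,u⁻²}, u = λ/μ the eigenvalue ratio of ρ(Frob_p) (both triples {−1,1,−1} at involution classes)
— "weak automorphic induction of ONE quadratic Hecke character along the sextic resolvent",
equivalently ζ_(E₁₂)/ζ_(E₆) = L(s,σ)L(s,σ′). K2 (RotationPairDescent): such a GL₃ pair descends to a
cuspidal π on GL₂ matching ρ a.e. (Ramakrishnan/GRS self-dual GL₃ = Ad(π) descent + exclusion of the
3/3′ and sign chimeras). No idea card is realised (novel-route seat, operator C barrier-inversion).
Lean: `ResolventInduction ∧ RotationPairDescent`

## Assembly
Pure logic, kernel-checked in the planner folder (Sketch.lean rc 0, `sector_of_cruxes`,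
`assembly_holds`; glue.lean `closes`): fix an even icosahedral ρ; K1 gives (hcpt₃, σ, σ′) with the
joint Satake property; K2 turns them into π on GL₂ matching ρ a.e.; this is the sector statement X
verbatim; the junction carries X to `Langlands`. `closes (h1 : ResolventInduction) (h2 :
RotationPairDescent) (hJ : EvenArtinJunction) : Langlands := hJ (fun ρ hi hA he => by obtain ⟨hcpt3,
σ, σ', hae⟩ := h1 ρ hi hA he; exact h2 ρ hi hA he hcpt3 σ σ' hae)` — every binder load-bearing.

Rationale: WHY THIS LINE. BARRIER INVERSION (operator C) on
Literature.Barriers.Langlands.SolvableImageBarrierNarrowInduction: assuming the wall (every chain of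
base change / restriction / induction along sub-solvable layers stays insoluble), the barrier audit
itself records the only door — functoriality along a NON-NORMAL layer of the A₅-field (quintic or
sextic) pins π(ρ). We type the WEAKEST such door for the EVEN case: one layer (the sextic
resolvent), one character (quadratic), because of the character identity Ind_(D₅)^(A₅) sgn = 3 ⊕ 3′
(SerreLinearRepresentations1977 §5 character table; checked by hand: (6,−2,0,1,1) = χ₃+χ₃′) and
because the rotation representation 3 = Ad ρ determines ρ up to twist, the descent GL₃ → GL₂ being a
THEOREM (Ramakrishnan2014 Thm A, via Gelbart–Jacquet GelbartJacquet1978 and Ginzburg–Rallis–Soudry;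
Ramakrishnan2000 for twist-uniqueness). So the twisted-endoscopy wall (self-duality) is used as a
resource — Ad ρ is orthogonal for free — and the NonRegularWeight wall is sidestepped: the λ = 1/4
Maass form is MANUFACTURED by the descent, never interpolated p-adically. What is imported:
Rankin–Selberg positivity for isobaric sums (JacquetShalikaAJM1981II, ArthurClozelAMS120 Ch. 3 Prop.
7.2), Hecke theory of E₆ (every GL₁-twist of the candidate is a Hecke L-function, hence entire with
functional equation; Voronoi summation then holds by arXiv:1508.01985 without automorphy),
non-solvable base change of COHOMOLOGICAL forms to totally real fields (Dieulefait2012,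
BarnetlambEtAl2014) for the cohomological half of a Cogdell–Piatetski-Shapiro converse attack on K1
(CogdellPiatetskishapiro1994). Precedents of the same problem type closed: non-normal CUBIC
induction (JPSS1981Cubique, Tunnell1981), the quintic A₅-induction in the ODD case (Kim2004, which
runs the implication the other way from modularity of ρ). No listed route uses the
resolvent/induction lever: the three even-icosahedral routes go p-adic through complex places or p =
2 (ParityBlindBianchi, EvenArtinGL4Door, EvenIcosahedralCMCorner), the analytic ones weight a trace
formula or a boundary function (GaloisWeightedBE, EvenArtinQuantumBoundary, HolomorphicShadow),
E8QuinticResidue runs direction (A) from Booker pairs.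

RANKED CRUXES. #0 Target (target) — even icosahedral strong Artin in Tunnell's a.e. sense (= shared
item stmt-Langlands-2903, derived inside `closes` from K1 and K2; not re-filed here). (why it might
fail: false only if Langlands (B) fails for an even icosahedral ρ/ℚ; no engine known (Calegari2023
§12).) [Calegari2023, DoudMoore2006, Booker2003]
#2 ResolventInduction (crux) — for every irreducible even icosahedral ρ : Γ_ℚ → GL₂(ℂ) there are
cuspidal σ, σ′ on GL₃(𝔸_ℚ) such that for almost every p the multiset Satake(σ)_p ⊔ Satake(σ′)_p
equals {u,1,u⁻¹} ⊔ {u²,1,u⁻²} (u = λ/μ for ρ(Frob_p) with eigenvalues λ, μ; the second triple is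
{−1,1,−1} when λ+μ = 0) — the eigenvalues of (Ad ρ ⊕ Ad ρ′)(Frob_p) = (Ind_(E₆)^ℚ η)(Frob_p); i.e.
the Hecke L-function ζ_(E₁₂)/ζ_(E₆) of the sextic resolvent is a product of two cuspidal GL(3)
standard L-functions (weak automorphic induction of η along E₆/ℚ, Rankin–Selberg positivity Σmᵢ² = 2
built in as the (3,3) shape). [difficulty: open-problem] (why it might fail: = functoriality for
ᴸ(Res_(E₆/ℚ)GL₁) → GL₆ at a quadratic character, insoluble (A₅) closure: every converse-theorem
attack needs L(s, τ × Ind η) for MAASS τ on GL_m/ℚ, m ≤ 4 (= weak base change of Maass forms to E₆),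
unknown; kernels/RTF programmes (Lafforgue, Getz) are unexecuted.) [Kim2004, JPSS1981Cubique,
CogdellPiatetskishapiro1994, Getz2012Nonsolvable, doi:10.1007/s11537-014-1274-y, arXiv:1508.01985,
Dieulefait2012, SerreLinearRepresentations1977]
#3 RotationPairDescent (crux) — for every irreducible even icosahedral ρ and every cuspidal pair σ,
σ′ on GL₃(𝔸_ℚ) with the joint Satake data of ResolventInduction, there is a cuspidal π on GL₂(𝔸_ℚ)
whose Satake parameters give charpoly ρ(Frob_v) at almost every v. Intended proof: (i) no 3/3′
chimera — one constituent carries exactly the rotation triple {u,1,u⁻¹} a.e. (Rankin–Selberg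
positivity forces balanced 5A/5B swaps; then rigidity); (ii) that constituent is self-dual with
trivial central character, hence = Ad(π) for a cuspidal π on GL₂ (Ramakrishnan2014 Thm A = tree item
SelfdualGL3AdjointLift stmt-Langlands-13621; the quadratic ambiguity ν is killed by the central
character); (iii) sign pin — the residual ambiguity t_(π,p) = ± eig ρ(Frob_p) is a Hecke character,
so a twist of π matches ρ (for ODD ρ this step is Deligne–Serre; here it is the crux). [deps:
ResolventInduction] [difficulty: XL] (why it might fail: sign/conjugate chimeras — t_(π,p) = ±eig
ρ(Frob_p) with non-character signs, or σ mixing 3/3′ on balanced halves of the 5A/5B primes — pass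
every accessible Rankin–Selberg identity (only even tensor powers of ρ are automorphic); exclusion
may need (A) for λ=1/4 forms.) [Ramakrishnan2014, Ramakrishnan2000, GelbartJacquet1978,
JacquetShalikaAJM1981II, KimShahidi2002, Booker2003]
#9 EvenArtinJunction (support) — X → Langlands: the rest of the summit (other n, other F, direction
(A), regular sectors, upgrade of a.e. matching to `Corresponds`); the shared junction
stmt-Langlands-2908 of every even-Artin route, filed verbatim so that `closes` ends in the summit
constant; never staffed from this route. [difficulty: open-problem] [BuzzardGeeLMS2014,
FontaineMazurGeometric1995]

TWO-LAYER PLAN. K1 ⇐ WeakResolventInductionShapeFree (two cuspidal constituents of shapes (3,3) ∨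
(1,5) ∨ (2,4), i.e. raw weak induction + Σmᵢ² = 2) → NoCharacterConstituent (pole of ζ at 1 vs
entire ζ_(E₁₂)/ζ_(E₆); provable modulo Jacquet–Shalika named facts) → NoRankTwoConstituent → K1
(bc/ResolventInduction_birth.lean, rc 0, 3 stubs). K2 ⇐ NoRotationChimera → AdjointDescentPin → K2
(bc/RotationPairDescent_birth.lean, rc 0, 2 stubs). Foreseen third split of AdjointDescentPin:
SelfdualFromRotationData (provable-now: inverse-closed Satake + SMO) → Ramakrishnan descent (named
fact) → SignPin. ALTERNATIVE LAYER for K1 (same wall, larger datum, no sign pin needed): weak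
induction along the degree-12 field E₁₂ of ONE Hecke character ψ of order 10 (Ind_(C₁₀)^(SL₂(𝔽₅)) ψ
= 2 ⊕ 4′ ⊕ 6 contains ρ itself), or along the quintic E₅ of the trivial character (ζ_(E₅)/ζ ↔ ρ ⊗
ρ′, then Kim's ∧²: GL₄ → GL₆ lands on 3 ⊕ 3′).

KILL CRITERIA. (1) The class-function identity behind K1 is finite A₅ arithmetic: if the multiset
{u,1,u⁻¹} ⊔ {u²,1,u⁻²} (involution rule included) is NOT the spectrum of (Ind_(D₅)^(A₅) sgn)(g) for
some class, K1/K2 are mis-typed → `refuted:ResolventInduction` (misstated), restate with the correct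
table. (2) A proof that sign chimeras cannot be excluded by any identity among L-functions of π, π′,
σ, σ′, Sym^k (k ≤ 4) and their Rankin–Selberg products is a BARRIER result for K2(iii): file it
under Literature/Barriers and pivot K2 to the degree-12 alternative layer (no pin). (3) A published
theorem "Ad ρ automorphic ⇒ ρ automorphic" for even ρ closes K2 as known (route survives, cheaper).
(4) If weak Maass base change to totally real fields is shown equivalent to full non-solvable base
change (no saving from η quadratic / Hecke twists), K1's why-easier collapses → close `superseded`
in favour of GaloisWeightedBE / AnalyticDescent. (5) Strong Artin for even icosahedral ρ proved
elsewhere moots the route.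

NOT DECOMPOSED YET. The converse-theorem attack on K1 (GL₆ Cogdell–PS: Hecke twists ✓, cohomological
GL_m-twists via non-solvable base change to the totally real E₆, Maass twists open) is deliberately
NOT filed as items (it would be a third layer); the positivity lemma Σmᵢ² = 2 and the pole exclusion
of a GL₁ constituent (provable modulo the tree's Jacquet–Shalika facts) ride as stubs/supports of
K1; the A₅ character identity is prose + kill criterion, not an item (Mathlib character theory of A₅
not assembled); local–global compatibility at ramified places and π_∞ = λ=1/4 principal series are
not claimed (a.e. target).

CHEAPEST FALSIFIER. Finite check, done by hand in NOTES.md and repeatable in minutes: the A₅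
character table gives Ind_(D₅)^(A₅) sgn = (6,−2,0,1,1) = χ₃ + χ₃′, and the eigenvalue rule u ↦ u² on
5-classes / identity on classes of order 1,2,3 reproduces traces 6, −2, 0, 1, 1 ✓. Next cheapest:
literature lookup whether "Artin for Ad ρ ⇒ Artin for ρ" is already settled for even ρ (searched
zbMATH: "adjoint lift icosahedral Maass", "selfdual GL(3) icosahedral" — 0 hits; Kim2004 WANTED
acq-04706 to read his §1 remarks).

NUMBERS. A₅ classes (sizes 1,15,20,12,12); χ₃ = (3,−1,0,φ,φ′), χ₃′ = (3,−1,0,φ′,φ), φφ′ = −1, φ+φ′ =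
1, φ²+φ′² = 3; Ind_(D₅) sgn = (6,−2,0,1,1); mean |χ₃|² over Frobenius classes = (9+15+0+12·3)/60 =
1; ⟨ρ₃⊕ρ₃′, ρ₃⊕ρ₃′⟩ = 2 (the Rankin–Selberg pole order Σmᵢ²). Smallest even icosahedral conductor:
1951 (DoudMoore2006; tree `DoudMooreEvenIcosahedral`). Items at open: 4 (2 cruxes, junction,
assembly) + target derived.

DEFINITION REQUESTS. None: every statement is typed over the Statement's cone (FramedGaloisRep,
HasFrobCharpolyAt, HasSatakeParamAt, satakePolynomial, CuspidalAutomorphicRepData); induced Artin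
representations are avoided by the ρ-intrinsic eigenvalue rule. Wanted literature: Kim2004 full text
(acq-04706).

Novelty: Searches (2026-08-17; searchd local index DOWN, OpenAlex/S2 rate-limited, zbMATH + galaxy used):
zbMATH "icosahedral automorphic induction" (1: Kim2004), "non-normal quintic automorphic induction"
(1: Kim2004), "icosahedral Artin conjecture even" (1: Booker–Lee–Strömbergsson 2020 twist-minimal
trace formulas), "adjoint lift icosahedral Maass" (0), "selfdual GL(3) icosahedral" (0); lit
frontier Langlands --since 2025 (30 rows, none on resolvent induction); galaxy --star all
"nonsolvable base change" / "automorphic induction for non-normal" / "Maass forms of eigenvalue 1/4"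
(0/0/0); tree: Literature.Barriers.Langlands.SolvableImageBarrierNarrowInduction (our own audit:
quintic+sextic layers jointly via Brauer/Green), Getz2012Nonsolvable (index-5 Ã₄ layer + beyond
endoscopy), Calegari2013ArtinS5 (reverse direction: 4-dim S₅ via 2-dim over ℚ(√5)).
Nearest prior art found: Kim2004 (doi:10.1007/s00222-003-0340-5: modularity of ODD icosahedral ρ ⇒
non-normal quintic induction — the converse direction); the tree's
SolvableImageBarrierNarrowInduction audit (two layers, Brauer); Ramakrishnan2014 Thm A (the descent
engine, never aimed at even Artin).
Delta: one non-normal layer and ONE quadratic character suffice for EVEN icosahedral strong Artin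
because Ind_(D₅)^(A₅) sgn = Ad ρ ⊕ Ad ρ′ and the self-dual GL₃ → GL₂ descent manufactures the Maass
form — a (B)-direction reduction of even icosahedral Artin to "ζ_(E₁₂)/ζ_(E₆) is a product of two
GL(3) L-functions" plus a typed chimera/pin st  [refs: 10.1007/s00222-003-0340-5:, doi:10.1007/s00222-003-0340-5, Kim2004, Ramakrishnan2014]

Barriers (technique_class: automorphic-induction, self-dual-descent, rs-positivity): - technique_class: automorphic-induction, self-dual-descent, rs-positivity
- Literature.Barriers.Langlands.SolvableImageBarrier: evaded through the recorded gap
(SolvableImageBarrierNarrow conjunct (2), NarrowInduction (ii)): the route never restricts ρ to a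
layer inside a solvable Galois extension; its only functoriality is induction along the NON-NORMAL
sextic layer E₆/ℚ (insoluble closure), for a character (image-blind); the bet is exactly that this
door opens.
- Literature.Barriers.Langlands.SolvableImageBarrierNarrow: same evasion, by name — conjunct (1)
(insoluble image inherited along sub-solvable layers) is never met because no restriction/base
change of ρ is used; the route sits exactly in the NOT-blocked conjuncts (2)–(4): functoriality
along the non-normal index-6 layer E₆/ℚ (the D₅-layer; the audit names the index-5 and index-6
layers as the gap).
- Literature.Barriers.Langlands.SolvableImageBarrierNarrowInduction: the audit's own door
(automorphic induction along the quintic AND sextic layers, Brauer/Green) is sharpened, not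
contradicted: for EVEN ρ the sextic layer alone with the sign character suffices because
Ind_(D₅)^(A₅) sgn = 3 ⊕ 3′ and the GL₃ → GL₂ self-dual descent replaces Brauer's virtual characters;
`brauer-induction` is not in this route's class.
- Literature.Barriers.Langlands.ShimuraVarietyRealizationBarrierNarrow: not met — the tag
`automorphic-induction` here is functoriality used in direction (B) over ℚ; no Galois representation
is read off any

History (route lifecycle, newest last):
- 2026-08-24T10:55:54Z · DORMANT — reconciler: no traction for 6.7 d (last activity item-evidence-added at 2026-08-17T17:02:34Z); parked, not closed — `ledger route dormant route-Langlands-Sextic (operator:999:193087)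
- 2026-08-29T09:42:22Z · REACTIVATED — reconciler: reactivated — activity statement-checked at 2026-08-29T08:15:59Z after parking at 2026-08-24T10:55:54Z (operator:999:3771548)

sub-problem: Langlands · status: open · opened operator:999:2956817 2026-08-17T01:37:00Z · rev 2 · ledger route-Langlands-SexticResolventInduction
GENERATED by the gate from the ledger (D-0016/17). Provers cite these decls: `theorem foo : Summit.Langlands.Langlands.Theses.SexticResolventInduction.<Decl> := …` in Summits/Langlands/Langlands/Theorems/<Name>.lean.
-/

namespace Summit.Langlands.Langlands.Theses.SexticResolventInduction

open scoped BigOperators Topology Manifold Classical MeasureTheory ProbabilityTheory Matrix InnerProductSpace ComplexConjugate ContinuousMap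
open Filter Set Function TopologicalSpace MeasureTheory

attribute [summit_statement] _root_.Langlands

/-- item stmt-Langlands-2903 · target · rank 0 · open · by planner
why it might fail: false only if Langlands (B) fails for an even icosahedral ρ/ℚ; no engine known (Calegari2023 §12).
sources: Calegari2023, DoudMoore2006, Booker2003
[target] strong Artin in Tunnell's a.e. sense for every irreducible even icosahedral ρ : Γ_ℚ →
GL₂(ℂ): ∃ cuspidal π on GL₂(𝔸_ℚ) with `IsPiOfArtinRep ρ π`. -/
@[route_item "route-Langlands-SexticResolventInduction"]
def Target : Prop :=
  ∀ ρ : Literature.NumberTheory.GaloisRepresentations.FramedGaloisRep ℚ ℂ 2, ρ.toGaloisRep.IsIrreducible → Nonempty ((Matrix.ProjGenLinGroup.mk.comp ρ.toMonoidHom).range ≃* alternatingGroup (Fin 5)) → (∀ (φ : ℚ →+* ℝ) (c : Field.absoluteGaloisGroup ℚ), Literature.NumberTheory.GaloisRepresentations.IsComplexConjugation φ c → Matrix.GeneralLinearGroup.det (ρ c) = 1) → ∃ (hcpt : Literature.NumberTheory.Automorphic.isCompact_glFiniteIntegralLevel 2 ℚ) (π : Literature.NumberTheory.Automorphic.CuspidalAutomorphicRepData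 2 ℚ hcpt), (∀ᶠ v : IsDedekindDomain.HeightOneSpectrum (NumberField.RingOfIntegers ℚ) in Filter.cofinite, ∃ α : Multiset ℂ, π.1.HasSatakeParamAt v α ∧ ρ.IsUnramifiedAt v ∧ ρ.HasFrobCharpolyAt v (Literature.NumberTheory.Automorphic.satakePolynomial α))

/-- item stmt-Langlands-17259 · crux · rank 2 · open · by operator
why it might fail: = functoriality for ᴸ(Res_(E₆/ℚ)GL₁) → GL₆ at a quadratic character, insoluble (A₅) closure: every converse-theorem attack needs L(s, τ × Ind η) for MAASS τ on GL_m/ℚ, m ≤ 4 (= weak base change of Maass forms to E₆), unknown; kernels/RTF programmes (Lafforgue, Getz) are unexecuted.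
sources: Kim2004, JPSS1981Cubique, CogdellPiatetskishapiro1994, Getz2012Nonsolvable, doi:10.1007/s11537-014-1274-y, arXiv:1508.01985
[crux] for every irreducible even icosahedral ρ : Γ_ℚ → GL₂(ℂ) there are cuspidal σ, σ′ on GL₃(𝔸_ℚ)
such that for almost every p the multiset Satake(σ)_p ⊔ Satake(σ′)_p equals {u,1,u⁻¹} ⊔ {u²,1,u⁻²}
(u = λ/μ for ρ(Frob_p) with eigenvalues λ, μ; the second triple is {−1,1,−1} when λ+μ = 0) — the
eigenvalues of (Ad ρ ⊕ Ad ρ′)(Frob_p) = (Ind_(E₆)^ℚ η)(Frob_p); i.e. the Hecke L-function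
ζ_(E₁₂)/ζ_(E₆) of the sextic resolvent is a product of two cuspidal GL(3) standard L-functions (weak
automorphic induction of η along E₆/ℚ, Rankin–Selberg positivity Σmᵢ² = 2 built in as the (3,3)
shape). [difficulty: open-problem] -/
@[route_item "route-Langlands-SexticResolventInduction", crux]
def ResolventInduction : Prop :=
  ∀ ρ : Literature.NumberTheory.GaloisRepresentations.FramedGaloisRep ℚ ℂ 2, ρ.toGaloisRep.IsIrreducible → Nonempty ((Matrix.ProjGenLinGroup.mk.comp ρ.toMonoidHom).range ≃* alternatingGroup (Fin 5)) → (∀ (φ : ℚ →+* ℝ) (c : Field.absoluteGaloisGroup ℚ), Literature.NumberTheory.GaloisRepresentations.IsComplexConjugation φ c → Matrix.GeneralLinearGroup.det (ρ c) = 1) → ∃ (hcpt3 : Literature.NumberTheory.Automorphic.isCompact_glFiniteIntegralLevel 3 ℚ) (σ σ' : Literature.NumberTheory.Automorphic.CuspidalAutomorphicRepData 3 ℚ hcpt3), ∀ᶠ v : IsDedekindDomain.HeightOneSpectrum (NumberField.RingOfIntegers ℚ) in Filter.cofinite, ∃ (α β : Multiset ℂ) (l m : ℂ), σ.1.HasSatakeParamAt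 v α ∧ σ'.1.HasSatakeParamAt v β ∧ ρ.IsUnramifiedAt v ∧ ρ.HasFrobCharpolyAt v (Literature.NumberTheory.Automorphic.satakePolynomial {l, m}) ∧ α + β = {l / m, 1, m / l} + (if l + m = 0 then {-1, 1, -1} else {(l / m) ^ 2, 1, (m / l) ^ 2})

/-- item stmt-Langlands-17260 · crux · rank 3 · open · by operator
why it might fail: sign/conjugate chimeras — t_(π,p) = ±eig ρ(Frob_p) with non-character signs, or σ mixing 3/3′ on balanced halves of the 5A/5B primes — pass every accessible Rankin–Selberg identity (only even tensor powers of ρ are automorphic); exclusion may need (A) for λ=1/4 forms.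
sources: Ramakrishnan2014, Ramakrishnan2000, GelbartJacquet1978, JacquetShalikaAJM1981II, KimShahidi2002, Booker2003
[crux] for every irreducible even icosahedral ρ and every cuspidal pair σ, σ′ on GL₃(𝔸_ℚ) with the
joint Satake data of ResolventInduction, there is a cuspidal π on GL₂(𝔸_ℚ) whose Satake parameters
give charpoly ρ(Frob_v) at almost every v. Intended proof: (i) no 3/3′ chimera — one constituent
carries exactly the rotation triple {u,1,u⁻¹} a.e. (Rankin–Selberg positivity forces balanced 5A/5B
swaps; then rigidity); (ii) that constituent is self-dual with trivial central character, hence =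
Ad(π) for a cuspidal π on GL₂ (Ramakrishnan2014 Thm A = tree item SelfdualGL3AdjointLift
stmt-Langlands-13621; the quadratic ambiguity ν is killed by the central character); (iii) sign pin
— the residual ambiguity t_(π,p) = ± eig ρ(Frob_p) is a Hecke character, so a twist of π matches ρ
(for ODD ρ this step is Deligne–Serre; here it is the crux). [deps: ResolventInduction] [difficulty:
XL] -/
@[route_item "route-Langlands-SexticResolventInduction", crux]
def RotationPairDescent : Prop :=
  ∀ ρ : Literature.NumberTheory.GaloisRepresentations.FramedGaloisRep ℚ ℂ 2, ρ.toGaloisRep.IsIrreducible → Nonempty ((Matrix.ProjGenLinGroup.mk.comp ρ.toMonoidHom).range ≃* alternatingGroup (Fin 5)) → (∀ (φ : ℚ →+* ℝ) (c : Field.absoluteGaloisGroup ℚ), Literature.NumberTheory.GaloisRepresentations.IsComplexConjugation φ c → Matrix.GeneralLinearGroup.det (ρ c) = 1) → ∀ (hcpt3 : Literature.NumberTheory.Automorphic.isCompact_glFiniteIntegralLevel 3 ℚ) (σ σ' : Literature.NumberTheory.Automorphic.CuspidalAutomorphicRepData 3 ℚ hcpt3), (∀ᶠ v : IsDedekindDomain.HeightOneSpectrum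 (NumberField.RingOfIntegers ℚ) in Filter.cofinite, ∃ (α β : Multiset ℂ) (l m : ℂ), σ.1.HasSatakeParamAt v α ∧ σ'.1.HasSatakeParamAt v β ∧ ρ.IsUnramifiedAt v ∧ ρ.HasFrobCharpolyAt v (Literature.NumberTheory.Automorphic.satakePolynomial {l, m}) ∧ α + β = {l / m, 1, m / l} + (if l + m = 0 then {-1, 1, -1} else {(l / m) ^ 2, 1, (m / l) ^ 2})) → ∃ (hcpt : Literature.NumberTheory.Automorphic.isCompact_glFiniteIntegralLevel 2 ℚ) (π : Literature.NumberTheory.Automorphic.CuspidalAutomorphicRepData 2 ℚ hcpt), (∀ᶠ v : IsDedekindDomain.HeightOneSpectrum (NumberField.RingOfIntegers ℚ) in Filter.cofinite, ∃ α : Multiset ℂ, π.1.HasSatakeParamAt v α ∧ ρ.IsUnramifiedAt v ∧ ρ.HasFrobCharpolyAt v (Literature.NumberTheory.Automorphic.satakePolynomial α))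

/-- item stmt-Langlands-2908 · support · rank 9 · open · by planner
sources: BuzzardGeeLMS2014, FontaineMazurGeometric1995
[support] X → Langlands: the rest of the summit (regular / totally-real–CM sectors, other n and F,
direction (A), and the upgrade of the a.e. `IsPiOfArtinRep` to `Corresponds` at every finite place
by local–global compatibility + strong multiplicity one). Not this route's business; filed so that
the Assembly ends in the summit constant; shared junction for every even-Artin card. [difficulty:
open-problem] -/
@[route_item "route-Langlands-SexticResolventInduction", crux]
def EvenArtinJunction : Prop :=
  (∀ ρ : Literature.NumberTheory.GaloisRepresentations.FramedGaloisRep ℚ ℂ 2, ρ.toGaloisRep.IsIrreducible → Nonempty ((Matrix.ProjGenLinGroup.mk.comp ρ.toMonoidHom).range ≃* alternatingGroup (Fin 5)) → (∀ (φ : ℚ →+* ℝ) (c : Field.absoluteGaloisGroup ℚ), Literature.NumberTheory.GaloisRepresentations.IsComplexConjugation φ c → Matrix.GeneralLinearGroup.det (ρ c) = 1) → ∃ (hcpt : Literature.NumberTheory.Automorphic.isCompact_glFiniteIntegralLevel 2 ℚ) (π : Literature.NumberTheory.Automorphic.CuspidalAutomorphicRepData 2 ℚ hcpt), (∀ᶠ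 v : IsDedekindDomain.HeightOneSpectrum (NumberField.RingOfIntegers ℚ) in Filter.cofinite, ∃ α : Multiset ℂ, π.1.HasSatakeParamAt v α ∧ ρ.IsUnramifiedAt v ∧ ρ.HasFrobCharpolyAt v (Literature.NumberTheory.Automorphic.satakePolynomial α))) → _root_.Langlands

/-- item stmt-Langlands-17261 · assembly · rank 1 · closed · proved by Summit.Langlands.Langlands.Theorems.sexticResolventInduction_assembly_proof (prover) · by operator
sources: BuzzardGeeLMS2014, Calegari2023
[assembly] ResolventInduction → RotationPairDescent → EvenArtinJunction → Langlands. -/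
@[route_item "route-Langlands-SexticResolventInduction"]
def Assembly : Prop :=
  ResolventInduction → RotationPairDescent → EvenArtinJunction → _root_.Langlands

-- `Assembly` holds: proved by `Summit.Langlands.Langlands.Theorems.sexticResolventInduction_assembly_proof` (its module imports this route file, so no `_holds` link can be stated here).

/-! D-0027 §2.1 — DECIDING THEOREM (planner-authored via `route open/edit --closes-file`; by operator:999:2956817 2026-08-17T01:37:00Z):
its hypotheses are this route's items and its conclusion the sub-problem Statement (glue_lint), and it elaborates with this file. -/

@[closes "route-Langlands-SexticResolventInduction"] theorem closes (h1 : ResolventInduction) (h2 : RotationPairDescent) (hJ : EvenArtinJunction) : _root_.Langlands :=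
  hJ (fun ρ hirr hico heven => (h1 ρ hirr hico heven).elim fun hcpt3 h => h.elim fun σ h' => h'.elim fun σ' hae => h2 ρ hirr hico heven hcpt3 σ σ' hae)

end Summit.Langlands.Langlands.Theses.SexticResolventInduction
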